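import Literature.Analysis.FluidPDE.ElgindiTheoremTwoLinear
import Literature.Analysis.FluidPDE.ElgindiL12SupBound
import Literature.Analysis.FluidPDE.ElgindiHkClosure
import Mathlib.Analysis.Calculus.UniformLimitsDeriv
import Mathlib.Topology.MetricSpace.Cauchy
import HarnessLib

/-!
# The corrector data `L₁₂(f_n)` along an `𝓗⁴`-approximating sequence converge in `C⁴_loc(0, ∞)`
([Elgindi2021] §7.5 Theorem 2, passage to the limit in the corrector)

Topic `Literature/Analysis/FluidPDE`. Support file (definitions with bodies and proved theorems, no
named facts) on the proof path of the named fact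
`Literature.Analysis.FluidPDE.Elgindi.ElgindiGhoulMasmoudi2021_stabilityCore`
(`ElgindiStabilityDecomposition.lean`). T. M. Elgindi, Ann. of Math. 194 (2021) =
arXiv:1904.04795, §7.5 (p. 24): `|L₁₂(F)| ≲ |F|_{𝓗⁰}`, `D_R L₁₂(F) = −(K,F)_θ`, and the radial
energies `A_j((K,F)_θ) ≲ |F|²_{𝓗⁴}` (`j ≤ 4`).

For an `𝓗⁴`-approximating sequence of test functions `f_n → F` (`HkApprox α F f`) the radial
functions `Λ_n = L₁₂(f_n)` are uniformly Cauchy on `ℝ`, and their scaling derivatives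
`D_R^jΛ_n = −D_R^{j−1}(K, f_n)_θ`, `j ≤ 4`, are locally uniformly Cauchy on `(0, ∞)` (a
one-dimensional Sobolev bound on compact intervals from the radial energies of orders `j−1, j`).
Hence (`HkApprox.exists_corrector_limit`) there is `Λ ∈ C⁴(0,∞)`, the uniform limit of `Λ_n`, with
`D_R^jΛ` the locally uniform limit of `D_R^jΛ_n` on `(0,∞)` for `j ≤ 4`.
-/

noncomputable section

open MeasureTheory Set Function Real Filter
open _root_.Topology
open scoped ENNReal ContDiff

namespace Literature.Analysis.FluidPDE

namespace Elgindi

/-! ### A one-dimensional Sobolev bound on compact intervals -/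

/-- Cauchy–Schwarz: `∫ |g| dμ ≤ (∫ g² dμ)^{1/2}·μ(univ)^{1/2}`. [folklore] -/
theorem lintegral_abs_le_sqrt_measure {X : Type*} [MeasurableSpace X] (μ : Measure X) {g : X → ℝ} (hg : AEMeasurable g μ) :
    ∫⁻ x, ENNReal.ofReal |g x| ∂μ ≤ (∫⁻ x, ENNReal.ofReal (g x ^ 2) ∂μ) ^ (1 / 2 : ℝ) * (μ univ) ^ (1 / 2 : ℝ) := by
  set Fq : X → ℝ≥0∞ := fun p => ENNReal.ofReal |g p| with hF
  have mF : AEMeasurable Fq μ := (continuous_abs.measurable.comp_aemeasurable hg).ennreal_ofReal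
  have hH := ENNReal.lintegral_mul_le_Lp_mul_Lq μ Real.HolderConjugate.two_two mF (aemeasurable_const (b := (1:ℝ≥0∞)))
  have e2 : ∀ (x : ℝ), 0 ≤ x → ENNReal.ofReal x ^ (2:ℝ) = ENNReal.ofReal (x ^ 2) := fun x hx => by
    rw [show (2:ℝ) = ((2:ℕ) : ℝ) by norm_num, ENNReal.rpow_natCast, ENNReal.ofReal_pow hx]
  have eF2 : ∀ p : X, Fq p ^ (2:ℝ) = ENNReal.ofReal (g p ^ 2) := fun p => by
    simp only [hF]; rw [e2 _ (abs_nonneg _), sq_abs]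
  have eF1 : ∀ p : X, (Fq * fun (_ : X) => (1:ℝ≥0∞)) p = ENNReal.ofReal |g p| := fun p => by
    simp only [Pi.mul_apply, mul_one, hF]
  simp_rw [eF1, eF2, ENNReal.one_rpow, lintegral_const, one_mul] at hH
  exact hH

/-- **Sup bound on an interval**: for `g ∈ C¹(ℝ)`, `a < b` and `x ∈ [a,b]`,
`|g(x)| ≤ (b−a)^{−1/2}(∫_{[a,b]} g²)^{1/2} + (b−a)^{1/2}(∫_{[a,b]} g′²)^{1/2}` (minimiser of `|g|` plus
the fundamental theorem of calculus, then Cauchy–Schwarz). [folklore] -/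
theorem ofReal_abs_le_interval {g : ℝ → ℝ} (hg : ContDiff ℝ 1 g) {a b x : ℝ} (hab : a < b) (hx : x ∈ Icc a b) :
    ENNReal.ofReal |g x| ≤ ENNReal.ofReal (1 / Real.sqrt (b - a)) * (∫⁻ t in Icc a b, ENNReal.ofReal (g t ^ 2)) ^ (1 / 2 : ℝ) +
      ENNReal.ofReal (Real.sqrt (b - a)) * (∫⁻ t in Icc a b, ENNReal.ofReal (deriv g t ^ 2)) ^ (1 / 2 : ℝ) := by
  have hgc : Continuous g := hg.continuous
  have hg'c : Continuous (deriv g) := hg.continuous_deriv le_rfl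
  have hba : 0 < b - a := sub_pos.2 hab
  have hvol : volume (Icc a b) = ENNReal.ofReal (b - a) := Real.volume_Icc
  -- a minimiser of `|g|` on `[a,b]`
  obtain ⟨x₀, hx₀, hmin⟩ := (isCompact_Icc (a := a) (b := b)).exists_isMinOn (nonempty_Icc.2 hab.le)
    (continuous_abs.comp hgc).continuousOn
  have hmin' : ∀ t ∈ Icc a b, |g x₀| ≤ |g t| := fun t ht => isMinOn_iff.1 hmin t ht
  -- (1) `(b - a)|g x₀| ≤ ∫ |g|`
  have h1 : ENNReal.ofReal (b - a) * ENNReal.ofReal |g x₀| ≤ ∫⁻ t in Icc a b, ENNReal.ofReal |g t| := by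
    calc ENNReal.ofReal (b - a) * ENNReal.ofReal |g x₀| = ∫⁻ _ in Icc a b, ENNReal.ofReal |g x₀| := by
          rw [setLIntegral_const, hvol, mul_comm]
      _ ≤ ∫⁻ t in Icc a b, ENNReal.ofReal |g t| := setLIntegral_mono' measurableSet_Icc fun t ht => ENNReal.ofReal_le_ofReal (hmin' t ht)
  -- (2) `|g x − g x₀| ≤ ∫ |g′|`
  have h2 : ENNReal.ofReal |g x - g x₀| ≤ ∫⁻ t in Icc a b, ENNReal.ofReal |deriv g t| := by
    have hint : IntegrableOn (fun t => |deriv g t|) (Icc a b) := (continuous_abs.comp hg'c).integrableOn_Icc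
    have hftc : ∫ t in x₀..x, deriv g t = g x - g x₀ :=
      intervalIntegral.integral_eq_sub_of_hasDerivAt (fun t _ => ((hg.differentiable one_ne_zero) t).hasDerivAt) (hg'c.intervalIntegrable _ _)
    rw [← hftc]
    have hsub : uIoc x₀ x ⊆ Icc a b := uIoc_subset_uIcc.trans (uIcc_subset_Icc hx₀ hx)
    have hle : |∫ t in x₀..x, deriv g t| ≤ ∫ t in Icc a b, |deriv g t| := by
      have h1 : |∫ t in x₀..x, deriv g t| ≤ ∫ t in uIoc x₀ x, |deriv g t| :=
        intervalIntegral.norm_integral_le_integral_norm_uIoc (f := deriv g) (μ := volume) (a := x₀) (b := x)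
      exact h1.trans (setIntegral_mono_set hint (ae_of_all _ fun t => abs_nonneg _) (ae_of_all _ hsub))
    calc ENNReal.ofReal |∫ t in x₀..x, deriv g t| ≤ ENNReal.ofReal (∫ t in Icc a b, |deriv g t|) := ENNReal.ofReal_le_ofReal hle
      _ = ∫⁻ t in Icc a b, ENNReal.ofReal |deriv g t| := ofReal_integral_eq_lintegral_ofReal hint (ae_of_all _ fun t => abs_nonneg _)
  -- (3) Cauchy–Schwarz
  have c1 := lintegral_abs_le_sqrt_measure (volume.restrict (Icc a b)) hgc.measurable.aemeasurable
  have c2 := lintegral_abs_le_sqrt_measure (volume.restrict (Icc a b)) hg'c.measurable.aemeasurable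
  rw [Measure.restrict_apply_univ, hvol] at c1 c2
  have hsq : ENNReal.ofReal (b - a) ^ (1 / 2 : ℝ) = ENNReal.ofReal (Real.sqrt (b - a)) := by
    rw [Real.sqrt_eq_rpow, ENNReal.ofReal_rpow_of_nonneg hba.le (by norm_num)]
  rw [hsq] at c1 c2
  -- combine
  have htri : ENNReal.ofReal |g x| ≤ ENNReal.ofReal |g x₀| + ENNReal.ofReal |g x - g x₀| := by
    rw [← ENNReal.ofReal_add (abs_nonneg _) (abs_nonneg _)]
    refine ENNReal.ofReal_le_ofReal ?_
    calc |g x| = |g x₀ + (g x - g x₀)| := by ring_nf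
      _ ≤ |g x₀| + |g x - g x₀| := abs_add_le _ _
  have hx0 : ENNReal.ofReal |g x₀| ≤ ENNReal.ofReal (1 / Real.sqrt (b - a)) * (∫⁻ t in Icc a b, ENNReal.ofReal (g t ^ 2)) ^ (1 / 2 : ℝ) := by
    have h := h1.trans c1
    have e1 : ENNReal.ofReal (1 / (b - a)) * ENNReal.ofReal (b - a) = 1 := by
      rw [← ENNReal.ofReal_mul (by positivity), one_div, inv_mul_cancel₀ hba.ne', ENNReal.ofReal_one]
    have e2 : ENNReal.ofReal (1 / (b - a)) * ENNReal.ofReal (Real.sqrt (b - a)) = ENNReal.ofReal (1 / Real.sqrt (b - a)) := by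
      rw [← ENNReal.ofReal_mul (by positivity)]
      congr 1
      rw [one_div_mul_eq_div, Real.sqrt_div_self']
    calc ENNReal.ofReal |g x₀| = ENNReal.ofReal (1 / (b - a)) * (ENNReal.ofReal (b - a) * ENNReal.ofReal |g x₀|) := by
          rw [← mul_assoc, e1, one_mul]
      _ ≤ ENNReal.ofReal (1 / (b - a)) * ((∫⁻ t in Icc a b, ENNReal.ofReal (g t ^ 2)) ^ (1 / 2 : ℝ) * ENNReal.ofReal (Real.sqrt (b - a))) :=
          mul_le_mul_right h _
      _ = _ := by rw [← mul_assoc, mul_comm _ (ENNReal.ofReal (Real.sqrt (b - a))), ← mul_assoc, mul_comm (ENNReal.ofReal (Real.sqrt _)), e2]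
  calc ENNReal.ofReal |g x| ≤ ENNReal.ofReal |g x₀| + ENNReal.ofReal |g x - g x₀| := htri
    _ ≤ _ := add_le_add hx0 ((h2.trans c2).trans_eq (mul_comm _ _))

/-! ### Scaling derivatives of differences -/

/-- `D_R(f − g) = D_Rf − D_Rg` for differentiable `f, g`. [folklore] -/
theorem Dz₁_sub {f g : ℝ → ℝ} (hf : Differentiable ℝ f) (hg : Differentiable ℝ g) : Dz₁ (f - g) = Dz₁ f - Dz₁ g := by
  funext x
  simp only [Dz₁_apply, Pi.sub_apply]
  rw [deriv_sub (hf x) (hg x)]; ring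

/-- `D_R^m(f − g) = D_R^mf − D_R^mg` for smooth `f, g`. [folklore] -/
theorem iterate_Dz₁_sub {f g : ℝ → ℝ} (hf : ContDiff ℝ ∞ f) (hg : ContDiff ℝ ∞ g) (m : ℕ) :
    Dz₁^[m] (f - g) = Dz₁^[m] f - Dz₁^[m] g := by
  induction m generalizing f g with
  | zero => rfl
  | succ m ih =>
    rw [Function.iterate_succ_apply, Function.iterate_succ_apply, Function.iterate_succ_apply,
      Dz₁_sub (hf.differentiable (by simp)) (hg.differentiable (by simp))]
    exact ih (contDiff_Dz₁_infty hf) (contDiff_Dz₁_infty hg)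

/-- `1 ≤ w(R)` for `R > 0`. [folklore] -/
theorem one_le_radialWeight {R : ℝ} (hR : 0 < R) : 1 ≤ radialWeight R := by
  unfold radialWeight; rw [le_div_iff₀ (by positivity)]; nlinarith

namespace NiceDatum

variable {h : ℝ → ℝ → ℝ} (hh : NiceDatum h)
include hh

/-- `(K, h)_θ` of a nice datum is smooth. [folklore] -/
theorem contDiff_kMomentF : ContDiff ℝ ∞ (kMoment h) := contDiff_infty.2 fun n => contDiff_kMoment (hh.smooth n) hh.supp

/-- `D_R^{i+1}L₁₂(h) = −D_R^i(K,h)_θ`. [cite: Elgindi2021, §6.2 proof of Proposition 6.9 (p. 17 of arXiv:1904.04795)] -/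
theorem iterate_Dz₁_L12_succ (i : ℕ) (x : ℝ) : (Dz₁^[i + 1] (L12 h)) x = -(Dz₁^[i] (kMoment h)) x := by
  rw [Function.iterate_succ_apply]
  have e : Dz₁ (L12 h) = fun z => -kMoment h z := funext fun z => Dz₁_L12 (hh.smooth 0).continuous hh.supp hh.sub z
  rw [e, iterate_Dz₁_neg]

/-- The radial energies of `(K,h)_θ` through `|h|²_{𝓗⁴}`: `A_j((K,h)_θ) ≤ (9π/32)|h|²_{𝓗⁴}`, `j ≤ 4`. [cite: Elgindi2021, §7.5 (p. 24 of arXiv:1904.04795)] -/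
theorem radialEnergy_kMoment_le_E4 (α : ℝ) {j : ℕ} (hj : j ≤ 4) :
    radialEnergy j (kMoment h) ≤ ENNReal.ofReal (9 * π / 32) * eHkNormSq α 4 h :=
  (radialEnergy_kMoment_le (hh.smooth j) hh.supp).trans (mul_le_mul_right (eL2Sq_hkRadialTerm_le α hj h) _)

/-- **Global sup bound**: `|L₁₂(h)(x)| ≤ √2·((9π/32)|h|²_{𝓗⁴})^{1/2}`. [cite: Elgindi2021, §7.5 (p. 24 of arXiv:1904.04795)] -/
theorem ofReal_abs_L12_le_E4 (α : ℝ) (x : ℝ) :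
    ENNReal.ofReal |L12 h x| ≤ ENNReal.ofReal (Real.sqrt 2) * (ENNReal.ofReal (9 * π / 32) * eHkNormSq α 4 h) ^ (1 / 2 : ℝ) :=
  (abs_L12_le (hh.smooth 0) hh.supp hh.sub x).trans
    (mul_le_mul_right (ENNReal.rpow_le_rpow (hh.radialEnergy_kMoment_le_E4 α (by norm_num)) (by norm_num)) _)

/-- **Local sup bound for the scaling derivatives of the corrector data**: for `1 ≤ j ≤ 4`,
`0 < a < b`, `x ∈ [a,b]`: `|D_R^jL₁₂(h)(x)| ≤ (1/√(b−a) + √(b−a)/a)·((9π/32)|h|²_{𝓗⁴})^{1/2}`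
(the one-dimensional Sobolev bound with `g = D_R^{j−1}(K,h)_θ`, `g′ = D_R^{j}(K,h)_θ/R`). [cite: Elgindi2021, §7.5 (p. 24 of arXiv:1904.04795)] -/
theorem ofReal_abs_iterate_Dz₁_L12_le (α : ℝ) {j : ℕ} (hj1 : 1 ≤ j) (hj : j ≤ 4) {a b x : ℝ} (ha : 0 < a) (hab : a < b)
    (hx : x ∈ Icc a b) :
    ENNReal.ofReal |(Dz₁^[j] (L12 h)) x| ≤ (ENNReal.ofReal (1 / Real.sqrt (b - a)) + ENNReal.ofReal (Real.sqrt (b - a) / a)) *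
      (ENNReal.ofReal (9 * π / 32) * eHkNormSq α 4 h) ^ (1 / 2 : ℝ) := by
  obtain ⟨i, rfl⟩ : ∃ i, j = i + 1 := ⟨j - 1, by omega⟩
  set g : ℝ → ℝ := Dz₁^[i] (kMoment h) with hgdef
  have hgs : ContDiff ℝ ∞ g := contDiff_iterate_Dz₁_infty hh.contDiff_kMomentF i
  have hg1 : ContDiff ℝ 1 g := hgs.of_le (by exact_mod_cast le_top)
  have e0 : |(Dz₁^[i + 1] (L12 h)) x| = |g x| := by rw [hh.iterate_Dz₁_L12_succ, abs_neg]
  rw [e0]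
  refine (ofReal_abs_le_interval hg1 hab hx).trans ?_
  set Q := ENNReal.ofReal (9 * π / 32) * eHkNormSq α 4 h with hQ
  -- the two interval integrals through the radial energies
  have hI0 : ∫⁻ t in Icc a b, ENNReal.ofReal (g t ^ 2) ≤ Q := by
    refine le_trans ?_ (hh.radialEnergy_kMoment_le_E4 α (show i ≤ 4 by omega))
    unfold radialEnergy
    refine (lintegral_mono_set (show Icc a b ⊆ Ioi 0 from fun t ht => lt_of_lt_of_le ha ht.1)).trans ?_
    refine setLIntegral_mono' measurableSet_Ioi fun t ht => ENNReal.ofReal_le_ofReal ?_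
    have hw := one_le_radialWeight (show 0 < t from ht)
    calc g t ^ 2 = 1 * g t ^ 2 := (one_mul _).symm
      _ ≤ radialWeight t ^ 2 * (Dz₁^[i] (kMoment h)) t ^ 2 := mul_le_mul_of_nonneg_right (by nlinarith) (sq_nonneg _)
  have hI1 : ∫⁻ t in Icc a b, ENNReal.ofReal (deriv g t ^ 2) ≤ ENNReal.ofReal (1 / a ^ 2) * Q := by
    have hder : ∀ t ∈ Icc a b, deriv g t = (Dz₁^[i + 1] (kMoment h)) t / t := fun t ht => by
      have ht0 : t ≠ 0 := (lt_of_lt_of_le ha ht.1).ne'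
      rw [Function.iterate_succ_apply', Dz₁_apply, mul_div_cancel_left₀ _ ht0]
    calc ∫⁻ t in Icc a b, ENNReal.ofReal (deriv g t ^ 2)
        ≤ ∫⁻ t in Icc a b, ENNReal.ofReal (1 / a ^ 2) * ENNReal.ofReal (radialWeight t ^ 2 * (Dz₁^[i + 1] (kMoment h)) t ^ 2) := by
          refine setLIntegral_mono' measurableSet_Icc fun t ht => ?_
          rw [← ENNReal.ofReal_mul (by positivity)]
          refine ENNReal.ofReal_le_ofReal ?_
          have ht : 0 < t := lt_of_lt_of_le ha ht.1
          have hw := one_le_radialWeight ht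
          rw [hder t ‹_›, div_pow]
          have hD := sq_nonneg ((Dz₁^[i + 1] (kMoment h)) t)
          calc (Dz₁^[i + 1] (kMoment h)) t ^ 2 / t ^ 2 ≤ (Dz₁^[i + 1] (kMoment h)) t ^ 2 / a ^ 2 := by
                gcongr; exact ‹t ∈ Icc a b›.1
            _ = 1 / a ^ 2 * (1 * (Dz₁^[i + 1] (kMoment h)) t ^ 2) := by ring
            _ ≤ 1 / a ^ 2 * (radialWeight t ^ 2 * (Dz₁^[i + 1] (kMoment h)) t ^ 2) := by
                refine mul_le_mul_of_nonneg_left (mul_le_mul_of_nonneg_right (by nlinarith) hD) (by positivity)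
      _ = ENNReal.ofReal (1 / a ^ 2) * ∫⁻ t in Icc a b, ENNReal.ofReal (radialWeight t ^ 2 * (Dz₁^[i + 1] (kMoment h)) t ^ 2) := by
          rw [lintegral_const_mul' _ _ ENNReal.ofReal_ne_top]
      _ ≤ ENNReal.ofReal (1 / a ^ 2) * radialEnergy (i + 1) (kMoment h) := by
          unfold radialEnergy
          exact mul_le_mul_right (lintegral_mono_set (show Icc a b ⊆ Ioi 0 from fun t ht => lt_of_lt_of_le ha ht.1)) _
      _ ≤ ENNReal.ofReal (1 / a ^ 2) * Q := mul_le_mul_right (hh.radialEnergy_kMoment_le_E4 α (show i + 1 ≤ 4 by omega)) _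
  have hI1' : (∫⁻ t in Icc a b, ENNReal.ofReal (deriv g t ^ 2)) ^ (1 / 2 : ℝ) ≤ ENNReal.ofReal (1 / a) * Q ^ (1 / 2 : ℝ) := by
    refine (ENNReal.rpow_le_rpow hI1 (by norm_num)).trans_eq ?_
    rw [ENNReal.mul_rpow_of_nonneg _ _ (by norm_num : (0:ℝ) ≤ 1 / 2), ENNReal.ofReal_rpow_of_nonneg (by positivity) (by norm_num)]
    congr 2
    rw [show (1 / a ^ 2 : ℝ) = (1 / a) ^ 2 by ring, ← Real.sqrt_eq_rpow, Real.sqrt_sq (by positivity)]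
  calc ENNReal.ofReal (1 / Real.sqrt (b - a)) * (∫⁻ t in Icc a b, ENNReal.ofReal (g t ^ 2)) ^ (1 / 2 : ℝ) +
        ENNReal.ofReal (Real.sqrt (b - a)) * (∫⁻ t in Icc a b, ENNReal.ofReal (deriv g t ^ 2)) ^ (1 / 2 : ℝ)
      ≤ ENNReal.ofReal (1 / Real.sqrt (b - a)) * Q ^ (1 / 2 : ℝ) + ENNReal.ofReal (Real.sqrt (b - a)) * (ENNReal.ofReal (1 / a) * Q ^ (1 / 2 : ℝ)) := by
        gcongr
    _ = _ := by
        rw [← mul_assoc, ← ENNReal.ofReal_mul (Real.sqrt_nonneg _), mul_one_div, add_mul]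

end NiceDatum

/-! ### Uniform limits and derivatives -/

/-- Uniform convergence survives division by `x` on sets bounded away from `0`. [folklore] -/
theorem tendstoUniformlyOn_div {Fs : ℕ → ℝ → ℝ} {f : ℝ → ℝ} {K : Set ℝ} {a : ℝ} (ha : 0 < a) (hK : ∀ x ∈ K, a ≤ x)
    (h : TendstoUniformlyOn Fs f atTop K) : TendstoUniformlyOn (fun n x => Fs n x / x) (fun x => f x / x) atTop K := by
  rw [Metric.tendstoUniformlyOn_iff] at h ⊢
  intro ε hε
  filter_upwards [h (ε * a) (by positivity)] with n hn x hx
  have hx0 : 0 < x := lt_of_lt_of_le ha (hK x hx)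
  have hn' := hn x hx
  rw [Real.dist_eq] at hn' ⊢
  rw [← sub_div, abs_div, abs_of_pos hx0, div_lt_iff₀ hx0]
  calc |f x - Fs n x| < ε * a := hn'
    _ ≤ ε * x := mul_le_mul_of_nonneg_left (hK x hx) hε.le

/-- One step of regularity: `f′ = g/x` on `(0,∞)` with `g ∈ Cⁿ(0,∞)` gives `f ∈ C^{n+1}(0,∞)`. [folklore] -/
theorem contDiffOn_succ_of_hasDerivAt_div {f g : ℝ → ℝ} {n : WithTop ℕ∞} (hn : n ≠ ⊤) (hd : ∀ x ∈ Ioi (0:ℝ), HasDerivAt f (g x / x) x)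
    (hg : ContDiffOn ℝ n g (Ioi 0)) : ContDiffOn ℝ (n + 1) f (Ioi 0) := by
  rw [contDiffOn_succ_iff_deriv_of_isOpen isOpen_Ioi]
  refine ⟨fun x hx => (hd x hx).differentiableAt.differentiableWithinAt, fun h => absurd h hn, ?_⟩
  have hq : ContDiffOn ℝ n (fun x => g x / x) (Ioi 0) := hg.div contDiffOn_id fun x hx => ne_of_gt hx
  exact hq.congr fun x hx => (hd x hx).deriv

/-! ### The corrector data along an approximating sequence -/

section approx

variable {α : ℝ} {F : ℝ → ℝ → ℝ} {fs : ℕ → ℝ → ℝ → ℝ} (hA : HkApprox α F fs)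
include hA

/-- The mutual `𝓗⁴`-distances along an approximating sequence are small: for `ε > 0` eventually
`|f_n − f_m|²_{𝓗⁴} ≤ ε`. [folklore] -/
theorem HkApprox.eventually_sub_sub_le {ε : ℝ≥0∞} (hε : 0 < ε) :
    ∃ N, ∀ n ≥ N, ∀ m ≥ N, eHkNormSq α 4 (fs n - fs m) ≤ ε := by
  have hN : ∀ n, NiceDatum (fs n) := fun n => ⟨(hA.test n).smooth, (hA.test n).supp, (hA.test n).sub⟩
  have hF4 : ContDiffOn ℝ 4 (uncurry F) strip :=
    hA.smooth.of_le (WithTop.coe_le_coe.2 le_top : (4 : WithTop ℕ∞) ≤ ((⊤ : ℕ∞) : WithTop ℕ∞))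
  have hε4 : 0 < ε / 4 := ENNReal.div_pos hε.ne' (by norm_num)
  obtain ⟨N, hNε⟩ := (ENNReal.tendsto_atTop_zero.1 hA.conv) (ε / 4) hε4
  refine ⟨N, fun n hn m hm => ?_⟩
  have e : fs n - fs m = (fs n - F) + (F - fs m) := by funext z θ; simp
  have hsymm : eHkNormSq α 4 (F - fs m) = eHkNormSq α 4 (fs m - F) := by
    have e' : F - fs m = (-1 : ℝ) • (fs m - F) := by funext z θ; simp
    rw [e', eHkNormSq_smul, Real.enorm_eq_ofReal_abs, abs_neg, abs_one, ENNReal.ofReal_one, one_pow, one_mul]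
  rw [e]
  refine (eHkNormSq_add_le (((hN n).smooth 4).contDiffOn.sub hF4) (hF4.sub ((hN m).smooth 4).contDiffOn)).trans ?_
  rw [hsymm]
  calc 2 * eHkNormSq α 4 (fs n - F) + 2 * eHkNormSq α 4 (fs m - F) ≤ 2 * (ε / 4) + 2 * (ε / 4) := by
        gcongr
        · exact hNε n hn
        · exact hNε m hm
    _ = ε := by
        rw [← add_mul, show (2:ℝ≥0∞) + 2 = 4 by norm_num, ENNReal.mul_div_cancel (by norm_num) (by norm_num)]

/-- The smallness mechanism: `C·((9π/32)|f_n − f_m|²_{𝓗⁴})^{1/2} ≤ ε/2` eventually, for a finite constant `C`. [folklore] -/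
theorem HkApprox.exists_N_of_const {C : ℝ≥0∞} (hC : C ≠ ⊤) {ε : ℝ} (hε : 0 < ε) :
    ∃ N, ∀ n ≥ N, ∀ m ≥ N, C * (ENNReal.ofReal (9 * π / 32) * eHkNormSq α 4 (fs n - fs m)) ^ (1 / 2 : ℝ) ≤ ENNReal.ofReal (ε / 2) := by
  have hcont : Tendsto (fun δ : ℝ≥0∞ => C * (ENNReal.ofReal (9 * π / 32) * δ) ^ (1 / 2 : ℝ)) (𝓝 0) (𝓝 0) := by
    have h1 : Tendsto (fun δ : ℝ≥0∞ => ENNReal.ofReal (9 * π / 32) * δ) (𝓝 0) (𝓝 0) := by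
      have := ENNReal.Tendsto.const_mul (tendsto_id (x := 𝓝 (0:ℝ≥0∞))) (Or.inr (ENNReal.ofReal_ne_top (r := 9 * π / 32)))
      rwa [mul_zero] at this
    have h2 : Tendsto (fun δ : ℝ≥0∞ => (ENNReal.ofReal (9 * π / 32) * δ) ^ (1 / 2 : ℝ)) (𝓝 0) (𝓝 0) := by
      have := ((ENNReal.continuous_rpow_const (y := (1 / 2 : ℝ))).tendsto (0:ℝ≥0∞)).comp h1
      rwa [ENNReal.zero_rpow_of_pos (by norm_num : (0:ℝ) < 1 / 2)] at this
    have := ENNReal.Tendsto.const_mul h2 (Or.inr hC)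
    rwa [mul_zero] at this
  have hε2 : (0:ℝ≥0∞) < ENNReal.ofReal (ε / 2) := ENNReal.ofReal_pos.2 (by positivity)
  obtain ⟨k, hk⟩ := ((hcont.comp ENNReal.tendsto_inv_nat_nhds_zero).eventually (ge_mem_nhds hε2)).exists
  obtain ⟨N, hN⟩ := hA.eventually_sub_sub_le (ENNReal.inv_pos.2 (ENNReal.natCast_ne_top k))
  refine ⟨N, fun n hn m hm => le_trans ?_ hk⟩
  simp only [Function.comp]
  gcongr
  exact hN n hn m hm

/-- **Uniform Cauchy bounds for the corrector data**: on a compact `K ⊆ (0,∞)` and for `j ≤ 4`,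
the functions `D_R^jL₁₂(f_n)` are uniformly Cauchy. [cite: Elgindi2021, §7.5 (p. 24 of arXiv:1904.04795)] -/
theorem HkApprox.uniformCauchySeqOn_iterate_Dz₁_L12 {j : ℕ} (hj : j ≤ 4) {K : Set ℝ} (hK : IsCompact K) (hKs : K ⊆ Ioi 0) :
    UniformCauchySeqOn (fun n => Dz₁^[j] (L12 (fs n))) atTop K := by
  have hNd : ∀ n, NiceDatum (fs n) := fun n => ⟨(hA.test n).smooth, (hA.test n).supp, (hA.test n).sub⟩
  rw [Metric.uniformCauchySeqOn_iff]
  intro ε hε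
  by_cases hne : K.Nonempty
  swap
  · exact ⟨0, fun m _ n _ x hx => absurd ⟨x, hx⟩ hne⟩
  -- `K ⊆ [a, b]`, `0 < a < b`
  set a := sInf K with ha
  set b := sSup K + 1 with hb
  have haK : a ∈ K := hK.sInf_mem hne
  have ha0 : 0 < a := hKs haK
  have hKab : ∀ x ∈ K, x ∈ Icc a b := fun x hx =>
    ⟨csInf_le hK.bddBelow hx, (le_csSup hK.bddAbove hx).trans (by simp [hb])⟩
  have hab : a < b := by have := le_csSup hK.bddAbove haK; simp only [hb]; linarith
  set Cst : ℝ≥0∞ := ENNReal.ofReal (Real.sqrt 2) + (ENNReal.ofReal (1 / Real.sqrt (b - a)) + ENNReal.ofReal (Real.sqrt (b - a) / a)) with hCst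
  have hCtop : Cst ≠ ⊤ := by simp [hCst]
  have hpt : ∀ (h : ℝ → ℝ → ℝ), NiceDatum h → ∀ x ∈ K,
      ENNReal.ofReal |(Dz₁^[j] (L12 h)) x| ≤ Cst * (ENNReal.ofReal (9 * π / 32) * eHkNormSq α 4 h) ^ (1 / 2 : ℝ) := by
    intro h hh x hx
    rcases Nat.eq_zero_or_pos j with hj0 | hj0
    · subst hj0
      exact (hh.ofReal_abs_L12_le_E4 α x).trans (mul_le_mul_left le_self_add _)
    · exact (hh.ofReal_abs_iterate_Dz₁_L12_le α hj0 hj ha0 hab (hKab x hx)).trans (mul_le_mul_left le_add_self _)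
  obtain ⟨N, hN⟩ := hA.exists_N_of_const hCtop hε
  refine ⟨N, fun m hm n hn x hx => ?_⟩
  have hdiff : NiceDatum (fs m - fs n) := (hNd m).diff (hNd n)
  have e : (Dz₁^[j] (L12 (fs m))) x - (Dz₁^[j] (L12 (fs n))) x = (Dz₁^[j] (L12 (fs m - fs n))) x := by
    have eL : L12 (fs m - fs n) = L12 (fs m) - L12 (fs n) := funext fun z => (hNd m).L12_sub (hNd n) z
    rw [eL, iterate_Dz₁_sub (hNd m).contDiff_L12F (hNd n).contDiff_L12F]; rfl
  rw [Real.dist_eq, e]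
  have h3 : ENNReal.ofReal |(Dz₁^[j] (L12 (fs m - fs n))) x| ≤ ENNReal.ofReal (ε / 2) := (hpt _ hdiff x hx).trans (hN m hm n hn)
  have := (ENNReal.ofReal_le_ofReal_iff (by positivity)).1 h3
  linarith

/-- **Global uniform Cauchy bound** for `L₁₂(f_n)` on `ℝ`. [cite: Elgindi2021, §7.5 (p. 24 of arXiv:1904.04795)] -/
theorem HkApprox.uniformCauchySeqOn_L12 : UniformCauchySeqOn (fun n => L12 (fs n)) atTop univ := by
  have hNd : ∀ n, NiceDatum (fs n) := fun n => ⟨(hA.test n).smooth, (hA.test n).supp, (hA.test n).sub⟩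
  rw [Metric.uniformCauchySeqOn_iff]
  intro ε hε
  obtain ⟨N, hN⟩ := hA.exists_N_of_const (ENNReal.ofReal_ne_top (r := Real.sqrt 2)) hε
  refine ⟨N, fun m hm n hn x _ => ?_⟩
  have hdiff : NiceDatum (fs m - fs n) := (hNd m).diff (hNd n)
  rw [Real.dist_eq, ← (hNd m).L12_sub (hNd n) x]
  have h3 : ENNReal.ofReal |L12 (fs m - fs n) x| ≤ ENNReal.ofReal (ε / 2) := (hdiff.ofReal_abs_L12_le_E4 α x).trans (hN m hm n hn)
  have := (ENNReal.ofReal_le_ofReal_iff (by positivity)).1 h3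
  linarith

/-- **The limit of the corrector data** along an `𝓗⁴`-approximating sequence: there are functions
`Λ = G 0, G 1, …, G 4` with `L₁₂(f_n) → Λ` uniformly on `ℝ`, `D_R^jL₁₂(f_n) → G j` locally
uniformly on `(0,∞)` (`j ≤ 4`), `G j` continuous with `(G j)′ = G (j+1)/R` on `(0,∞)` (`j ≤ 3`); hence
`Λ ∈ C⁴(0,∞)` and `D_R^jΛ = G j` on `(0,∞)`. [cite: Elgindi2021, §7.5 (p. 24 of arXiv:1904.04795)] -/
theorem HkApprox.exists_corrector_limit :
    ∃ G : ℕ → ℝ → ℝ,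
      TendstoUniformly (fun n => L12 (fs n)) (G 0) atTop ∧
      (∀ j ≤ 4, TendstoLocallyUniformlyOn (fun n => Dz₁^[j] (L12 (fs n))) (G j) atTop (Ioi 0)) ∧
      (∀ j ≤ 4, ContinuousOn (G j) (Ioi 0)) ∧
      (∀ j ≤ 3, ∀ x ∈ Ioi 0, HasDerivAt (G j) (G (j + 1) x / x) x) ∧
      ContDiffOn ℝ 4 (G 0) (Ioi 0) ∧
      (∀ j ≤ 4, ∀ x ∈ Ioi 0, (Dz₁^[j] (G 0)) x = G j x) := by
  have hNd : ∀ n, NiceDatum (fs n) := fun n => ⟨(hA.test n).smooth, (hA.test n).supp, (hA.test n).sub⟩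
  set Gs : ℕ → ℕ → ℝ → ℝ := fun j n => Dz₁^[j] (L12 (fs n)) with hGs
  have hsmooth : ∀ j n, ContDiff ℝ ∞ (Gs j n) := fun j n => contDiff_iterate_Dz₁_infty (hNd n).contDiff_L12F j
  have hU0 : UniformCauchySeqOn (Gs 0) atTop univ := hA.uniformCauchySeqOn_L12
  have hUK : ∀ j ≤ 4, ∀ K ⊆ Ioi 0, IsCompact K → UniformCauchySeqOn (Gs j) atTop K :=
    fun j hj K hKs hK => hA.uniformCauchySeqOn_iterate_Dz₁_L12 hj hK hKs
  -- the pointwise limits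
  set G : ℕ → ℝ → ℝ := fun j x => limUnder atTop (fun n => Gs j n x) with hG
  have hlim0 : ∀ x, Tendsto (fun n => Gs 0 n x) atTop (𝓝 (G 0 x)) := fun x =>
    tendsto_nhds_limUnder (cauchySeq_tendsto_of_complete (hU0.cauchySeq (mem_univ x)))
  have hlim : ∀ j ≤ 4, ∀ x ∈ Ioi (0:ℝ), Tendsto (fun n => Gs j n x) atTop (𝓝 (G j x)) := fun j hj x hx =>
    tendsto_nhds_limUnder (cauchySeq_tendsto_of_complete
      ((hUK j hj {x} (singleton_subset_iff.2 hx) isCompact_singleton).cauchySeq (mem_singleton x)))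
  have hTU : TendstoUniformly (Gs 0) (G 0) atTop :=
    tendstoUniformlyOn_univ.1 (hU0.tendstoUniformlyOn_of_tendsto fun x _ => hlim0 x)
  have hTLU : ∀ j ≤ 4, TendstoLocallyUniformlyOn (Gs j) (G j) atTop (Ioi 0) := fun j hj =>
    (tendstoLocallyUniformlyOn_iff_forall_isCompact isOpen_Ioi).2 fun K hKs hK =>
      (hUK j hj K hKs hK).tendstoUniformlyOn_of_tendsto fun x hx => hlim j hj x (hKs hx)
  have hcontG : ∀ j ≤ 4, ContinuousOn (G j) (Ioi 0) := fun j hj =>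
    (hTLU j hj).continuousOn (Frequently.of_forall fun n => (hsmooth j n).continuous.continuousOn)
  -- derivatives
  have hderGs : ∀ j n, ∀ x ∈ Ioi (0:ℝ), HasDerivAt (Gs j n) (Gs (j + 1) n x / x) x := by
    intro j n x hx
    have hx0 : x ≠ 0 := ne_of_gt hx
    have hd : HasDerivAt (Gs j n) (deriv (Gs j n) x) x := (((hsmooth j n).differentiable (by simp)) x).hasDerivAt
    refine hd.congr_deriv ?_
    simp only [hGs]
    rw [Function.iterate_succ_apply', Dz₁_apply]
    field_simp
  have hTLU' : ∀ j ≤ 3, TendstoLocallyUniformlyOn (fun n x => Gs (j + 1) n x / x) (fun x => G (j + 1) x / x) atTop (Ioi 0) := by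
    intro j hj
    refine (tendstoLocallyUniformlyOn_iff_forall_isCompact isOpen_Ioi).2 fun K hKs hK => ?_
    by_cases hne : K.Nonempty
    · have haK : sInf K ∈ K := hK.sInf_mem hne
      have ha0 : 0 < sInf K := hKs haK
      exact tendstoUniformlyOn_div ha0 (fun x hx => csInf_le hK.bddBelow hx)
        ((tendstoLocallyUniformlyOn_iff_forall_isCompact isOpen_Ioi).1 (hTLU (j + 1) (by omega)) K hKs hK)
    · rw [not_nonempty_iff_eq_empty.1 hne]
      exact tendstoUniformlyOn_empty
  have hderG : ∀ j ≤ 3, ∀ x ∈ Ioi (0:ℝ), HasDerivAt (G j) (G (j + 1) x / x) x := fun j hj x hx =>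
    hasDerivAt_of_tendstoLocallyUniformlyOn isOpen_Ioi (g' := fun y => G (j + 1) y / y) (hTLU' j hj)
      (Eventually.of_forall fun n => hderGs j n) (fun y hy => hlim j (by omega) y hy) hx
  -- regularity of `Λ = G 0`
  have c4 : ContDiffOn ℝ 0 (G 4) (Ioi 0) := contDiffOn_zero.2 (hcontG 4 le_rfl)
  have c3 : ContDiffOn ℝ 1 (G 3) (Ioi 0) := by
    rw [show (1 : WithTop ℕ∞) = 0 + 1 by norm_num]
    exact contDiffOn_succ_of_hasDerivAt_div (by simp) (hderG 3 le_rfl) c4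
  have c2 : ContDiffOn ℝ 2 (G 2) (Ioi 0) := by
    rw [show (2 : WithTop ℕ∞) = 1 + 1 by norm_num]
    exact contDiffOn_succ_of_hasDerivAt_div (by simp) (hderG 2 (by norm_num)) c3
  have c1 : ContDiffOn ℝ 3 (G 1) (Ioi 0) := by
    rw [show (3 : WithTop ℕ∞) = 2 + 1 by norm_num]
    exact contDiffOn_succ_of_hasDerivAt_div (by simp) (hderG 1 (by norm_num)) c2
  have c0 : ContDiffOn ℝ 4 (G 0) (Ioi 0) := by
    rw [show (4 : WithTop ℕ∞) = 3 + 1 by norm_num]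
    exact contDiffOn_succ_of_hasDerivAt_div (by simp) (hderG 0 (by norm_num)) c1
  -- `D_R^jΛ = G j` on `(0,∞)`
  have key : ∀ j ≤ 4, ∀ x ∈ Ioi (0:ℝ), (Dz₁^[j] (G 0)) x = G j x := by
    intro j
    induction j with
    | zero => intro _ x _; rfl
    | succ j ih =>
      intro hj x hx
      have hx0 : x ≠ 0 := ne_of_gt hx
      have hev : (Dz₁^[j] (G 0)) =ᶠ[𝓝 x] G j :=
        Filter.eventuallyEq_of_mem (isOpen_Ioi.mem_nhds hx) fun y hy => ih (by omega) y hy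
      rw [Function.iterate_succ_apply', Dz₁_apply, hev.deriv_eq, (hderG j (by omega) x hx).deriv]
      field_simp
  exact ⟨G, hTU, hTLU, hcontG, hderG, c0, key⟩

end approx

end Elgindi

end Literature.Analysis.FluidPDE
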